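import Summits.QuantumFields.YangMills.Theorems.SwapVirialDeficitBlowUpGnomonicBFibreDefs
import Summits.QuantumFields.YangMills.Theorems.SwapVirialDeficitConeMeasureHubCot
import Summits.QuantumFields.YangMills.Theorems.SwapVirialDeficitBlowUpGnomonicHubShiftSmooth
import Summits.QuantumFields.YangMills.Theorems.SwapVirialDeficitSectorLaplaceBulkFibred
import HarnessLib

/-!
# STUB (S-B) OF SKELETON ➎, WIRING: the fibred √b law of the stratum-B tubes on `X = ℝ × GnoCoord L` (hub letter `δ` in the fibre), SOCKETS AS HYPOTHESES
# (free-hands support of ⟨stmt-QuantumFields-24197⟩ `SwapVirialDeficit.SwapGluedStiffness` ∕ ⟨24194⟩; cell ym-idea-1, LEAD g98 memo7 ∕ 19:34Z: BTube = {|δ| small} × {|u| ≥ τ})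

After ✓`lintegral_chartMeasure_hubCot` a ➎ region integral `∫_R e^{−bF̂_ε} d(chartMeasure)` is `coneConst·π·∫∫ 𝟙_R e^{−bF̂_{hubAt δ 1,ε}(η)} ((1+δ²)⁻¹)²ρ(η) dδ dη`, an
integral on `X := ℝ × GnoCoord L` against `μ_B := vol·J_B`, `J_B(δ,η) = ((1+δ²)⁻¹)²·ρ(η)`.  For the B-tube the Laplace variables are the fibre letters
`(δ, x₀, y₀ | y_⊥ | z | η_F) ∈ V_B` of ✓`gnoFibreBEquiv` over the base `u ∈ S ⊆ ℝ²`, and the region is the slab-cylinder `{|δ| ≤ τ′} ∩ {u ∈ S}`.  This file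
applies ✓`laplaceMethod_quantitative_fibred_chart_cubic_offBound_on` to exactly that geometry, with the ANALYTIC SOCKETS AS HYPOTHESES (to be delivered by w3's
B-floors ✓`fibre_raySecond_ge_stratumB_joint` ∕ `_diag` ∕ `_hubPolar` and the joint `(δ,η)`-line jets — see the STATUS request «taylor_four_gnoDeficit_hubLine»):
* §1 letters: `bDeficit ε (δ,η) := F̂_{hubAt δ 1, ε}(η)` as a measurable function on `X` (w3 ✓`contDiff_gnoDeficit_hubShift` at the equatorial hub `hubAt 0 1`),
  `isFiniteMeasure_muB`, the slab-cylinder and its measurability, `volume_muB_restrict_bTube_eq_map` (tube chart identity from ✓`volume_withDensity_eq_map_gnoFibreBEquiv`);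
* §2 ★★★ `bTube_fibred_cylinder` — GIVEN operators `A u` on `V_B` (symmetric, measurable, uniformly coercive on `S`), a cubic datum `|ρ′| ≤ A₃‖y‖³` with
  `bDeficit(Ψ_B(u,y)) = ½⟪A u y,y⟫ + ρ′(u,y)` on the tube, an amplitude `J_B(Ψ_B(u,y)) = w₀(u)(1 + e′(u,y))`, `|e′| ≤ D‖y‖`, `w₀` integrable on `S`, and a far floor
  `λR² ≤ bDeficit` on the slab-cylinder off the tube (`R ≤ τ′`), THEN
  `|∫_{slab-cyl} e^{−b·bDeficit} dμ_B − (2π∕b)^{(2α+1)∕2}∫_S w₀∕√det A| ≤ (K₃∕√b + 16(m_B+8)∕(λR²b))·Main + e^{−bλR²}·μ_B(X)`.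

HONEST LABEL: wiring only — every analytic input of the B-tube law is a HYPOTHESIS here; (S-B), (S-core), (S-001), ⟨24197⟩ ∕ ⟨24194⟩ OPEN; own crux ⟨22884⟩ OPEN (blocked-on
⟨19935⟩); the Yang–Mills mass gap is NOT proved; no summit is proved by a line.  THEOREMS ONLY (0 `def`, 0 `sorry`), standard axioms.  Width seat ym-line-sfw-p2-w2 g59
(cell ym-idea-1, free hands), `--supports stmt-QuantumFields-24197`.  References: [cite: Luscher1983, §2]; [cite: HasenpflugRudolfSprungk2024, App. 4.1 Thm 16]; [folklore].
-/

set_option autoImplicit false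
set_option synthInstance.maxSize 1024

noncomputable section

open MeasureTheory Quaternion Set Metric Module
open scoped Quaternion BigOperators ENNReal InnerProductSpace
open Literature.MathematicalPhysics.QuantumLattice
open Literature.MathematicalPhysics.QuantumFieldTheory hiding SU2
open Summit.QuantumFields.YangMills.Theorems.SwapTwistDeficit.ToronLog

namespace Summit.QuantumFields.YangMills.Theorems.SwapVirialDeficit.BlowUpRing

open Summit.QuantumFields.YangMills.Theorems.FemtoTransferGap
open Summit.QuantumFields.YangMills.Theorems.FemtoTransferGap.TT
open Summit.QuantumFields.YangMills.Theorems.VirialFluxGap.RingDeficit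
open Summit.QuantumFields.YangMills.Theorems.SwapVirialDeficit.SwapRing
open Summit.QuantumFields.YangMills.Theorems.SwapVirialDeficit.Gnomonic (contDiff_gnoDeficit_hubShift)
open Summit.QuantumFields.YangMills.Theorems.QuantitativeLaplace (laplaceMethod_quantitative_fibred_chart_cubic_offBound_on offTube_bound_of_cylinder
  restrict_image_eq_map_of_measurableEquiv)

variable {L : ℕ} [NeZero L]

/-! ## §1 Letters: the B-deficit on `ℝ × GnoCoord L`, the measure `μ_B`, the slab-cylinder, the tube chart identity -/

omit [NeZero L] in
/-- `hubAt δ 1 = hubAt 0 1 − (−δ)·1`: the hub with letter `δ` is a REAL SHIFT of the equatorial hub (w3's hub-shift family). [folklore] -/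
theorem hubAt_eq_equator_sub_smul (δ : ℝ) : hubAt δ 1 = hubAt 0 1 - (-δ) • (1 : ℍ) := by
  rw [hubAt, hubAt]
  ext <;> simp

omit [NeZero L] in
/-- The equatorial hub `hubAt 0 1 = (0, 1, 0, 0)` has non-zero imaginary part. [folklore] -/
theorem hubAt_zero_one_im_ne_zero : (hubAt 0 1).im ≠ 0 := by
  intro h
  have h1 := congrArg QuaternionAlgebra.imI h
  simp [hubAt] at h1

/-- ★ `(δ, η) ↦ F̂_{hubAt δ 1, ε}(η)` is continuous, hence measurable, on `ℝ × GnoCoord L` (w3 ✓`contDiff_gnoDeficit_hubShift`). [folklore] -/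
theorem measurable_bDeficit (z : Fin 3 → Bool) (χ : Site 3 L → SU2) (ε : GnoSign L) :
    Measurable fun p : ℝ × GnoCoord L => gnoDeficit z χ (hubAt p.1 1) ε p.2 := by
  have hc := (contDiff_gnoDeficit_hubShift (n := 0) z χ hubAt_zero_one_im_ne_zero ε (L := L)).continuous
  have e : (fun p : ℝ × GnoCoord L => gnoDeficit z χ (hubAt p.1 1) ε p.2) =
      (fun p : ℝ × GnoCoord L => gnoDeficit z χ (hubAt 0 1 - p.1 • (1 : ℍ)) ε p.2) ∘ fun p : ℝ × GnoCoord L => (-p.1, p.2) := by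
    funext p; simp only [Function.comp_apply, hubAt_eq_equator_sub_smul p.1]
  rw [e]
  exact hc.measurable.comp (measurable_fst.neg.prodMk measurable_snd)

/-- The B-density `J_B(δ,η) = ((1+δ²)⁻¹)²·ρ(η)` is measurable and positive. [folklore] -/
theorem measurable_bDensity : Measurable fun p : ℝ × GnoCoord L => ((1 + p.1 ^ 2)⁻¹) ^ 2 * gnoDensity p.2 :=
  (((measurable_const.add (measurable_fst.pow_const 2)).inv).pow_const 2).mul (measurable_gnoDensity.comp measurable_snd)

/-- `0 < J_B`. [folklore] -/
theorem bDensity_pos (p : ℝ × GnoCoord L) : 0 < ((1 + p.1 ^ 2)⁻¹) ^ 2 * gnoDensity p.2 := mul_pos (by positivity) (gnoDensity_pos _)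

/-- `μ_B = vol·J_B` is a finite measure (`∫(1+δ²)⁻² ≤ ∫(1+δ²)⁻¹ < ∞`, ✓`integrable_gnoDensity`). [folklore] -/
theorem isFiniteMeasure_muB :
    IsFiniteMeasure ((volume : Measure (ℝ × GnoCoord L)).withDensity fun p => ENNReal.ofReal (((1 + p.1 ^ 2)⁻¹) ^ 2 * gnoDensity p.2)) := by
  refine isFiniteMeasure_withDensity_ofReal ?_
  have h1 : Integrable (fun δ : ℝ => ((1 + δ ^ 2)⁻¹) ^ 2) := by
    refine (integrable_inv_one_add_sq).mono' ((((measurable_const.add (measurable_id.pow_const 2)).inv).pow_const 2).aestronglyMeasurable)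
      (Filter.Eventually.of_forall fun δ => ?_)
    have h0 : 0 ≤ (1 + δ ^ 2)⁻¹ := by positivity
    have h1 : (1 + δ ^ 2)⁻¹ ≤ 1 := by rw [inv_le_one_iff₀]; right; nlinarith [sq_nonneg δ]
    rw [Real.norm_eq_abs, abs_of_nonneg (by positivity)]
    nlinarith
  have h := h1.mul_prod (integrable_gnoDensity (L := L))
  exact h.hasFiniteIntegral

/-- The slab-cylinder `{|δ| ≤ τ′} ∩ {(η_x 1, η_x 2) ∈ S}` is measurable. [folklore] -/
theorem measurableSet_slabCylinder {S : Set (ℝ × ℝ)} (hS : MeasurableSet S) (τ' : ℝ) :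
    MeasurableSet ({p : ℝ × GnoCoord L | |p.1| ≤ τ'} ∩ {p : ℝ × GnoCoord L | (p.2.1.1 1, p.2.1.1 2) ∈ S}) := by
  refine (measurableSet_le measurable_fst.abs measurable_const).inter ?_
  rw [← gnoFibreBEquiv_image_prod_univ]
  exact measurableSet_cylinderB hS

/-- ★ **THE B-TUBE CHART IDENTITY** over a measurable base set `S`: the tube image `Ψ_B(S × B̄_R)` is measurable and
`μ_B|_{Ψ_B(S × B̄_R)} = (Ψ_B)_*(((vol ⊗ vol)|_{S × B̄_R})·(J_B ∘ Ψ_B))`. [folklore] -/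
theorem volume_muB_restrict_bTube_eq_map {S : Set (ℝ × ℝ)} (hS : MeasurableSet S) (R : ℝ) :
    MeasurableSet (gnoFibreBEquiv '' (S ×ˢ closedBall (0 : GnoFibreB L) R)) ∧
    ((volume : Measure (ℝ × GnoCoord L)).withDensity (fun p => ENNReal.ofReal (((1 + p.1 ^ 2)⁻¹) ^ 2 * gnoDensity p.2))).restrict
        (gnoFibreBEquiv '' (S ×ˢ closedBall (0 : GnoFibreB L) R)) =
      ((((volume : Measure (ℝ × ℝ)).prod (volume : Measure (GnoFibreB L))).restrict (S ×ˢ closedBall (0 : GnoFibreB L) R)).withDensity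
        (fun q => ENNReal.ofReal (((1 + (gnoFibreBEquiv q).1 ^ 2)⁻¹) ^ 2 * gnoDensity (gnoFibreBEquiv q).2))).map (gnoFibreBEquiv (L := L)) :=
  restrict_image_eq_map_of_measurableEquiv (κ := (volume : Measure (ℝ × ℝ)).prod (volume : Measure (GnoFibreB L))) (gnoFibreBEquiv (L := L))
    (volume_withDensity_eq_map_gnoFibreBEquiv (ENNReal.measurable_ofReal.comp measurable_bDensity)) (hS.prod measurableSet_closedBall)

/-- The hub letter of `Ψ_B(u, y)` is the `δ`-coordinate of `y`, bounded by `‖y‖`. [folklore] -/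
theorem abs_delta_gnoFibreBEquiv_le (u : ℝ × ℝ) (y : GnoFibreB L) : |(gnoFibreBEquiv (u, y)).1| ≤ ‖y‖ := by
  rw [gnoFibreBEquiv_apply']
  show |y (Sum.inl (Sum.inl 0))| ≤ ‖y‖
  have h := norm_sq_gnoFibreB y
  have h1 : y (Sum.inl (Sum.inl 0)) ^ 2 ≤ ‖y‖ ^ 2 := by
    rw [h]
    have a : y (Sum.inl (Sum.inl 0)) ^ 2 ≤ Gnomonic.normSq3 (gnoFibreBBlocks y).1.1 := by
      simp only [Gnomonic.normSq3, gnoFibreBBlocks, Fin.sum_univ_three]; nlinarith [sq_nonneg (y (Sum.inl (Sum.inl 1))), sq_nonneg (y (Sum.inl (Sum.inl 2)))]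
    have b : 0 ≤ (gnoFibreBBlocks y).1.2 0 ^ 2 + (gnoFibreBBlocks y).1.2 1 ^ 2 := by positivity
    have c : 0 ≤ Gnomonic.normSq3 (gnoFibreBBlocks y).2.1 := Gnomonic.normSq3_nonneg _
    have d : 0 ≤ ∑ f, Gnomonic.normSq3 ((gnoFibreBBlocks y).2.2 f) := Finset.sum_nonneg fun f _ => Gnomonic.normSq3_nonneg _
    linarith
  exact abs_le_of_sq_le_sq' h1 (norm_nonneg y) |> fun h => abs_le.2 h

/-! ## §2 The B-tube law, sockets as hypotheses -/

/-- ★★★ **THE FIBRED √b LAW OF THE STRATUM-B TUBES (wiring; sockets as hypotheses).**  Signs `ε`; base set `S ⊆ ℝ²` measurable with a point `p₀`; slab `|δ| ≤ τ′`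
with `0 < R ≤ τ′`; operators `A u` on `V_B` (symmetric and `λ`-coercive for `u ∈ S`, `(u,y) ↦ ⟪A u y,y⟫` measurable); cubic datum `ρ′`, amplitude defect `e′` measurable with
`bDeficit(Ψ_B(u,y)) − 0 = ½⟪A u y,y⟫ + ρ′(u,y)`, `|ρ′| ≤ A₃‖y‖³`, `J_B(Ψ_B(u,y)) = w₀(u)(1 + e′(u,y))`, `|e′| ≤ D‖y‖` on the tube; `w₀ ≥ 0` measurable, integrable on `S`; far
floor `λR² ≤ bDeficit` on the slab-cylinder off the tube; `A₃R ≤ λ∕(8(m_B+8))`, `DR ≤ 1`, `0 < b`.  Then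
`|∫_{slab-cyl} e^{−b·bDeficit} dμ_B − (2π∕b)^{m_B∕2}∫_S w₀∕√det A| ≤ (K₃∕√b + 16(m_B+8)∕(λR²b))·(2π∕b)^{m_B∕2}∫_S w₀∕√det A + e^{−bλR²}·μ_B(X)`.
[cite: Luscher1983, §2] [cite: HasenpflugRudolfSprungk2024, App. 4.1 Thm 16] -/
theorem bTube_fibred_cylinder (ε : GnoSign L) {S : Set (ℝ × ℝ)} (hS : MeasurableSet S) {p₀ : ℝ × ℝ} (hp₀ : p₀ ∈ S) {τ' : ℝ}
    {A : ℝ × ℝ → GnoFibreB L →ₗ[ℝ] GnoFibreB L} (hAs : ∀ u ∈ S, (A u).IsSymmetric) {lam : ℝ} (hlam : 0 < lam)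
    (hcoer : ∀ u ∈ S, ∀ y : GnoFibreB L, lam * ‖y‖ ^ 2 ≤ ⟪A u y, y⟫_ℝ)
    (hAm : Measurable fun q : (ℝ × ℝ) × GnoFibreB L => ⟪A q.1 q.2, q.2⟫_ℝ)
    {R A₃ D b : ℝ} (hR : 0 < R) (hRτ : R ≤ τ') (hA₃ : 0 ≤ A₃) (hD : 0 ≤ D) (hb : 0 < b)
    (hsmall : A₃ * R ≤ lam / (8 * ((finrank ℝ (GnoFibreB L) : ℝ) + 8))) (hDR : D * R ≤ 1)
    {ρ' e' : (ℝ × ℝ) × GnoFibreB L → ℝ} (hρm : Measurable ρ') (hem : Measurable e') {w₀ : ℝ × ℝ → ℝ} (hw₀m : Measurable w₀)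
    (hw₀ : ∀ u ∈ S, 0 ≤ w₀ u) (hw₀i : IntegrableOn w₀ S)
    (hρ : ∀ u ∈ S, ∀ y : GnoFibreB L, ‖y‖ ≤ R → |ρ' (u, y)| ≤ A₃ * ‖y‖ ^ 3)
    (hη : ∀ u ∈ S, ∀ y : GnoFibreB L, ‖y‖ ≤ R → |e' (u, y)| ≤ D * ‖y‖)
    (hf : ∀ u ∈ S, ∀ y : GnoFibreB L, ‖y‖ ≤ R →
      gnoDeficit (fun _ => false) (fun _ => 1) (hubAt (gnoFibreBEquiv (u, y)).1 1) ε (gnoFibreBEquiv (u, y)).2 - 0 = (1 / 2) * ⟪A u y, y⟫_ℝ + ρ' (u, y))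
    (hw : ∀ u ∈ S, ∀ y : GnoFibreB L, ‖y‖ ≤ R →
      ((1 + (gnoFibreBEquiv (u, y)).1 ^ 2)⁻¹) ^ 2 * gnoDensity (gnoFibreBEquiv (u, y)).2 = w₀ u * (1 + e' (u, y)))
    (hfar : ∀ u ∈ S, ∀ y : GnoFibreB L, R ≤ ‖y‖ → |(gnoFibreBEquiv (u, y)).1| ≤ τ' →
      lam * R ^ 2 ≤ gnoDeficit (fun _ => false) (fun _ => 1) (hubAt (gnoFibreBEquiv (u, y)).1 1) ε (gnoFibreBEquiv (u, y)).2) :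
    |(∫ p in {p : ℝ × GnoCoord L | |p.1| ≤ τ'} ∩ {p : ℝ × GnoCoord L | (p.2.1.1 1, p.2.1.1 2) ∈ S},
          Real.exp (-(b * gnoDeficit (fun _ => false) (fun _ => 1) (hubAt p.1 1) ε p.2))
          ∂((volume : Measure (ℝ × GnoCoord L)).withDensity fun p => ENNReal.ofReal (((1 + p.1 ^ 2)⁻¹) ^ 2 * gnoDensity p.2))) -
        (2 * Real.pi / b) ^ ((finrank ℝ (GnoFibreB L) : ℝ) / 2) * ∫ u in S, w₀ u / Real.sqrt (LinearMap.det (A u))| ≤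
      ((16 * A₃ * ((finrank ℝ (GnoFibreB L) : ℝ) + 8) / lam + 256 * A₃ * ((finrank ℝ (GnoFibreB L) : ℝ) + 8) ^ 2 / lam ^ 2 + D +
            8 * D * ((finrank ℝ (GnoFibreB L) : ℝ) + 8) / lam) / Real.sqrt b + 16 * ((finrank ℝ (GnoFibreB L) : ℝ) + 8) / (lam * R ^ 2) / b) *
        ((2 * Real.pi / b) ^ ((finrank ℝ (GnoFibreB L) : ℝ) / 2) * ∫ u in S, w₀ u / Real.sqrt (LinearMap.det (A u))) +
      Real.exp (-(b * (lam * R ^ 2))) *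
        ((volume : Measure (ℝ × GnoCoord L)).withDensity fun p => ENNReal.ofReal (((1 + p.1 ^ 2)⁻¹) ^ 2 * gnoDensity p.2)).real univ := by
  set μB : Measure (ℝ × GnoCoord L) := (volume : Measure (ℝ × GnoCoord L)).withDensity fun p => ENNReal.ofReal (((1 + p.1 ^ 2)⁻¹) ^ 2 * gnoDensity p.2) with hμB
  haveI : IsFiniteMeasure μB := isFiniteMeasure_muB
  set f : ℝ × GnoCoord L → ℝ := fun p => gnoDeficit (fun _ => false) (fun _ => 1) (hubAt p.1 1) ε p.2 with hfdef
  have hfm : Measurable f := measurable_bDeficit _ _ ε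
  set Rg : Set (ℝ × GnoCoord L) := {p : ℝ × GnoCoord L | |p.1| ≤ τ'} ∩ {p : ℝ × GnoCoord L | (p.2.1.1 1, p.2.1.1 2) ∈ S} with hRg
  have hRgm : MeasurableSet Rg := measurableSet_slabCylinder hS τ'
  set φ : ℝ × GnoCoord L → ℝ := Rg.indicator (fun _ => (1 : ℝ)) with hφ
  have hφm : Measurable φ := measurable_const.indicator hRgm
  obtain ⟨hTm, hchart⟩ := volume_muB_restrict_bTube_eq_map (L := L) hS R
  have hJm : Measurable fun q : (ℝ × ℝ) × GnoFibreB L => ((1 + (gnoFibreBEquiv q).1 ^ 2)⁻¹) ^ 2 * gnoDensity (gnoFibreBEquiv q).2 :=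
    measurable_bDensity.comp measurable_gnoFibreBEquiv
  -- membership of tube points in the slab-cylinder
  have hmemRg : ∀ u ∈ S, ∀ y : GnoFibreB L, ‖y‖ ≤ R → gnoFibreBEquiv (u, y) ∈ Rg := by
    intro u hu y hy
    refine ⟨?_, ?_⟩
    · show |(gnoFibreBEquiv (u, y)).1| ≤ τ'
      exact ((abs_delta_gnoFibreBEquiv_le u y).trans hy).trans hRτ
    · show ((gnoFibreBEquiv (u, y)).2.1.1 1, (gnoFibreBEquiv (u, y)).2.1.1 2) ∈ S
      rw [gnoFibreBEquiv_apply']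
      exact hu
  -- `hw` with the cut-off `φ`
  have hw' : ∀ u ∈ S, ∀ y : GnoFibreB L, ‖y‖ ≤ R →
      ((1 + (gnoFibreBEquiv (u, y)).1 ^ 2)⁻¹) ^ 2 * gnoDensity (gnoFibreBEquiv (u, y)).2 * φ (gnoFibreBEquiv (u, y)) = w₀ u * (1 + e' (u, y)) := by
    intro u hu y hy
    rw [hφ, indicator_of_mem (hmemRg u hu y hy), mul_one]
    exact hw u hu y hy
  -- the off-tube bound
  have hoff : ∀ x, x ∉ gnoFibreBEquiv '' (S ×ˢ closedBall (0 : GnoFibreB L) R) → ‖Real.exp (-(b * (f x - 0))) * φ x‖ ≤ 1 * Real.exp (-(b * (lam * R ^ 2))) := by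
    refine offTube_bound_of_cylinder (C := Rg) hb.le (fun x hx => by rw [hφ, indicator_of_notMem hx]) zero_le_one
      (fun x hx => by rw [hφ, indicator_of_mem hx, abs_one]) fun x hx hxT => ?_
    have hcyl : x ∈ gnoFibreBEquiv '' (S ×ˢ (univ : Set (GnoFibreB L))) := by
      rw [gnoFibreBEquiv_image_prod_univ]; exact hx.2
    obtain ⟨u, hu, y, hRy, rfl⟩ := exists_of_mem_cylinderB_not_mem_tube hcyl hxT
    rw [zero_add, hfdef]
    have h := hfar u hu y hRy.le (by rw [gnoFibreBEquiv_apply]; exact hx.1)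
    rw [gnoFibreBEquiv_apply] at h
    exact h
  -- apply the generic law
  obtain ⟨-, hbd⟩ := laplaceMethod_quantitative_fibred_chart_cubic_offBound_on (X := ℝ × GnoCoord L) (μ := μB) (M := ℝ × ℝ) (ν := volume) (V := GnoFibreB L)
    (Ψ := gnoFibreBEquiv) (J := fun q => ((1 + (gnoFibreBEquiv q).1 ^ 2)⁻¹) ^ 2 * gnoDensity (gnoFibreBEquiv q).2) (f := f) (φ := φ) (f₀ := 0)
    hS hp₀ (A := A) hAs hlam hcoer hAm (R := R) (A₃ := A₃) (D := D) (β := b) (Eoff := 1 * Real.exp (-(b * (lam * R ^ 2))))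
    hR hA₃ hD hb hsmall hDR measurable_gnoFibreBEquiv hTm hJm (fun q _ => (bDensity_pos _).le) hchart hfm hφm hρm hem hw₀m hw₀ hw₀i
    hρ hη (fun u hu y hy => hf u hu y hy) hw' (by positivity) (Filter.Eventually.of_forall hoff)
  -- read back: the cut-off integral is the set integral over the slab-cylinder
  rw [one_mul] at hbd
  have hlhs : ∫ x, Real.exp (-(b * (f x - 0))) * φ x ∂μB = ∫ p in Rg, Real.exp (-(b * f p)) ∂μB := by
    rw [← integral_indicator hRgm]
    refine integral_congr_ae (Filter.Eventually.of_forall fun x => ?_)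
    show Real.exp (-(b * (f x - 0))) * φ x = Rg.indicator (fun p => Real.exp (-(b * f p))) x
    by_cases hx : x ∈ Rg
    · rw [hφ, indicator_of_mem hx, indicator_of_mem hx, sub_zero, mul_one]
    · rw [hφ, indicator_of_notMem hx, indicator_of_notMem hx, mul_zero]
  rw [hlhs] at hbd
  exact hbd

end Summit.QuantumFields.YangMills.Theorems.SwapVirialDeficit.BlowUpRing

end
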